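import Summits.AnomalousDissipation.AnomalousDissipation.Theorems.SolenoidalFractalHomogenisationLagrangianStepVmodSSReduce
import HarnessLib

/-!
# K1L_D (stmt-AnomalousDissipation-27980): (V_mod) flat stage, block (ss) — the CONSTANT MODE and the bridge `BssNZ → Bss`
(line file of the (V_mod) lane; prover ad-sawtooth-k1loc-p1 g14; on top of `…VmodSSReduce`.)

* `fc_starProjection_zero` — the Leray projection keeps the zero mode;
* `fc_apply_zero_eq` — MEAN CONSERVATION for every propagator window map with a bounded, a.e. weakly divergence-free carrier and an elliptic
  constant tensor: `𝓕(U s t x)(0) = 𝓕x(0)` (the `k = 0` instance of the modewise identity `ae_inner_mFourierCoeff_eq`: symbol and transport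
  factors vanish at `k = 0`; weak continuity of the orbit to reach every time);
* `apply_eq_self_of_supp_zero` — a datum supported on the zero mode (a solenoidal constant) is FIXED by every such `U s t` (mean conservation +
  contraction + Parseval);
* **`bss_of_bssNZ : BssNZ_textE e → Bss_textE e`** (PROVED): split `x = x₀ + x′`, `ζ = ζ₀ + ζ′` at the zero mode; `(U−T)x₀ = 0`, the zero mode of
  `(U−T)x′` vanishes (class preservation), losses only grow.
With `…VmodSSReduce`: **`Bss_textE e ⇐ SSMode_textE e`** — the (ss) block of the flat clause is EXACTLY the single-real-mode-pair modewise bound.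
`sorry`-free; NOT a proof of (ss), of the stub, of K1L_D or AD; rung F-D1.A0.
-/

set_option linter.dupNamespace false

noncomputable section

namespace Summit.AnomalousDissipation.AnomalousDissipation.Theorems.SolenoidalFractalHomogenisation.LagrangianStep.VmodFlat

open Literature.Analysis Literature.Analysis.FluidPDE Literature.Analysis.FunctionSpaces
open MeasureTheory Set Filter UnitAddTorus
open scoped ENNReal NNReal InnerProductSpace
open Summit.AnomalousDissipation.AnomalousDissipation.Theorems.SolenoidalFractalHomogenisation.LagrangianStep.CellClauseMod
open Summit.AnomalousDissipation.AnomalousDissipation.Theorems.SolenoidalFractalHomogenisation.LagrangianStep.LossCurrency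
open Summit.AnomalousDissipation.AnomalousDissipation.Theorems.SolenoidalFractalHomogenisation.RealisedQuasiStaticCellLaw
  (isSmooth_cell isDivFree_cell memLp_top_stLift_cell)

/-! ## §1 The zero mode -/

/-- The Leray projection keeps the zero mode (the constants are solenoidal). [folklore] -/
theorem fc_starProjection_zero (y : V2) : fc ((Torus.divFreeL2 (Fin 3)).starProjection y) 0 = fc y 0 := by
  have h := Torus.mFourierCoeff_zero_eq_zero_of_mem_divFreeL2_orthogonal ((Torus.divFreeL2 (Fin 3)).sub_starProjection_mem_orthogonal y)
  have e : fc (y - (Torus.divFreeL2 (Fin 3)).starProjection y) 0 = 0 := h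
  rw [fc_sub] at e
  exact (sub_eq_zero.1 e).symm

/-- The symbol of a constant tensor vanishes at the zero frequency. -/
theorem symbT_zero_freq (𝔹 : Torus.Visc4 (Fin 3)) (z : EuclideanSpace ℂ (Fin 3)) : Torus.symbT 𝔹 0 z = 0 := by
  ext j
  simp

set_option maxHeartbeats 800000 in
/-- **MEAN CONSERVATION** for a propagator with bounded, a.e. weakly divergence-free carrier and elliptic constant tensor:
`𝓕(U s t x)(0) = 𝓕x(0)` for all `x ∈ V2`, `0 ≤ s ≤ t ≤ T₀`. [folklore] -/
theorem fc_apply_zero_eq {T₀ : ℝ} {𝔹 : Torus.Visc4 (Fin 3)} {lo' hi' : ℝ} (h𝔹 : Torus.NearIso 𝔹 lo' hi') (hlo' : 0 < lo')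
    {b : ℝ → VF} (hb : MemLp (Torus.stLift b) ∞ (volume.restrict (Ioo 0 T₀ ×ˢ (univ : Set (EuclideanSpace ℝ (Fin 3))))))
    (hbdiv : ∀ᵐ τ ∂(volume.restrict (Ioo (0:ℝ) T₀)), Torus.IsWeaklyDivFree (b τ))
    {U : ℝ → ℝ → (V2 →L[ℝ] V2)} (hU : Torus.IsPropagator T₀ b 𝔹 U)
    {s t : ℝ} (hs : 0 ≤ s) (hst : s ≤ t) (htT : t ≤ T₀) (x : V2) : fc (U s t x) 0 = fc x 0 := by
  set P := (Torus.divFreeL2 (Fin 3)).starProjection with hP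
  -- reduce to the solenoidal part
  rw [hU.apply_eq_apply_starProjection s t x, ← fc_starProjection_zero x]
  set y : V2 := P x with hy
  have hydiv : Torus.IsWeaklyDivFree (⇑y : VF) := (Torus.mem_divFreeL2_iff _).1 ((Torus.divFreeL2 (Fin 3)).starProjection_apply_mem x)
  rcases lt_or_eq_of_le (hst.trans htT) with hsT | hsT
  swap
  · have hts : t = s := le_antisymm (hsT ▸ htT) hst
    rw [hts, hU.self_of_divFree s hs (le_of_eq hsT) y hydiv]
  set L : ℝ := T₀ - s with hL
  have hL0 : 0 < L := by rw [hL]; linarith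
  -- a Lions weak solution from `y` on the window, representing the orbit
  obtain ⟨v, hv⟩ := Torus.exists_windowSol h𝔹 hlo' hb hbdiv hs hsT (Lp.memLp y) hydiv
  have hrepr := hU.repr s hs hsT (y : VF) (Lp.memLp y) hydiv v hv
  rw [← hL] at hv
  rw [Lp.toLp_coeFn] at hrepr
  -- the zero mode of `v` is constant in time: the `k = 0` modewise identity
  have hyi : Integrable (⇑y : VF) volume := integrable_coe_V2 y
  have hmode : ∀ j : Fin 3, ∀ᵐ τ ∂(volume.restrict (Ioo 0 L)),
      ⟪mFourierCoeff (EuclideanSpace.complexify ∘ v τ) 0, EuclideanSpace.single j (1:ℂ)⟫_ℂ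
        = ⟪mFourierCoeff (EuclideanSpace.complexify ∘ (⇑y : VF)) 0, EuclideanSpace.single j (1:ℂ)⟫_ℂ := by
    intro j
    have hid := hv.ae_inner_mFourierCoeff_eq hyi 0 (z := EuclideanSpace.single j (1:ℂ)) (by simp)
    filter_upwards [hid] with τ hτ
    rw [hτ]
    simp only [symbT_zero_freq, inner_zero_right, mul_zero, Pi.zero_apply, Int.cast_zero, zero_mul,
      Finset.sum_const_zero, add_zero, Complex.ofReal_zero, integral_zero]
  have hall := (ae_all_iff (μ := volume.restrict (Ioo 0 L))).2 hmode
  have hv0 : ∀ᵐ τ ∂(volume.restrict (Ioo 0 L)), mFourierCoeff (EuclideanSpace.complexify ∘ v τ) 0 = fc y 0 := by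
    filter_upwards [hall] with τ hτ
    ext j
    have h := hτ j
    rw [EuclideanSpace.inner_single_right, EuclideanSpace.inner_single_right, one_mul, one_mul] at h
    have := congrArg (starRingEnd ℂ) h
    simpa [fc] using this
  -- hence along the orbit, a.e. in the lag
  have horbit : ∀ᵐ τ ∂(volume.restrict (Ioo 0 L)), ‖fc (U s (s + τ) y - y) 0‖ ^ 2 = 0 := by
    filter_upwards [hrepr, hv0] with τ hτ hτ0
    obtain ⟨hm, he⟩ := hτ
    rw [fc_sub, ← he]
    have : fc (MemLp.toLp (v τ) hm) 0 = mFourierCoeff (EuclideanSpace.complexify ∘ v τ) 0 :=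
      Torus.mFourierCoeff_congr_ae (Filter.EventuallyEq.fun_comp (MemLp.coeFn_toLp _) EuclideanSpace.complexify) 0
    rw [this, hτ0, sub_self, norm_zero]; ring
  -- weak continuity of `τ ↦ U s (s+τ) y − y` and of its zero mode
  have hmaps : MapsTo (fun τ : ℝ => s + τ) (Icc 0 L) (Icc s T₀) := fun τ hτ => ⟨by linarith [hτ.1], by rw [hL] at hτ; linarith [hτ.2]⟩
  have hFw : ∀ z : V2, ContinuousOn (fun τ => ⟪U s (s + τ) y - y, z⟫_ℝ) (Icc 0 L) := fun z => by
    have h1 : ContinuousOn (fun τ => ⟪U s (s + τ) y, z⟫_ℝ) (Icc 0 L) :=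
      (hU.continuousOn s hs hsT.le y z).comp (continuous_const.add continuous_id).continuousOn hmaps
    have e : (fun τ => ⟪U s (s + τ) y - y, z⟫_ℝ) = fun τ => ⟪U s (s + τ) y, z⟫_ℝ - ⟪y, z⟫_ℝ := by
      funext τ; rw [inner_sub_left]
    rw [e]; exact h1.sub continuousOn_const
  have hfc : ContinuousOn (fun τ => 2 * ‖fc (U s (s + τ) y - y) 0‖ ^ 2) (Icc 0 L) := by
    have h := PropagatorSymm.continuousOn_sum_norm_sq_modeCoeff hFw 0
    refine h.congr fun τ _ => ?_
    simp only [FlatWindow.sum_norm_sq_modeCoeff_coe, fc]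
  have hae : ∀ᵐ τ ∂(volume.restrict (Ioo 0 L)), 2 * ‖fc (U s (s + τ) y - y) 0‖ ^ 2 ≤ (fun _ => (0:ℝ)) τ := by
    filter_upwards [horbit] with τ hτ; rw [hτ]; simp
  have hle := Torus.le_on_Icc_of_ae_le_of_continuousOn₂ hL0 hfc continuousOn_const hae (t - s) ⟨by linarith, by rw [hL]; linarith⟩
  have e : s + (t - s) = t := by ring
  simp only [e] at hle
  have h0 : ‖fc (U s t y - y) 0‖ ^ 2 = 0 := le_antisymm (by linarith) (sq_nonneg _)
  have h1 : fc (U s t y - y) 0 = 0 := norm_eq_zero.1 (pow_eq_zero_iff two_ne_zero |>.1 h0)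
  rw [fc_sub] at h1
  exact sub_eq_zero.1 h1

/-- **A datum supported on the zero mode is FIXED** by every such propagator window map (mean conservation + contraction + Parseval). [folklore] -/
theorem apply_eq_self_of_supp_zero {T₀ : ℝ} {𝔹 : Torus.Visc4 (Fin 3)} {lo' hi' : ℝ} (h𝔹 : Torus.NearIso 𝔹 lo' hi') (hlo' : 0 < lo')
    {b : ℝ → VF} (hb : MemLp (Torus.stLift b) ∞ (volume.restrict (Ioo 0 T₀ ×ˢ (univ : Set (EuclideanSpace ℝ (Fin 3))))))
    (hbdiv : ∀ᵐ τ ∂(volume.restrict (Ioo (0:ℝ) T₀)), Torus.IsWeaklyDivFree (b τ))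
    {U : ℝ → ℝ → (V2 →L[ℝ] V2)} (hU : Torus.IsPropagator T₀ b 𝔹 U)
    {s t : ℝ} (hs : 0 ≤ s) (hst : s ≤ t) (htT : t ≤ T₀) (x : V2) (hx : ∀ k, k ≠ 0 → fc x k = 0) : U s t x = x := by
  have h0 := fc_apply_zero_eq h𝔹 hlo' hb hbdiv hU hs hst htT x
  -- Parseval: `‖x‖² = ‖𝓕x(0)‖²`, `‖U x‖² = Σ_k ‖𝓕(Ux)(k)‖² ≤ ‖x‖²`
  have hPx := hasSum_norm_sq_fcoeff x
  have hPU := hasSum_norm_sq_fcoeff (U s t x)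
  have hx2 : ‖x‖ ^ 2 = ‖fc x 0‖ ^ 2 := by
    have h := hasSum_single (f := fun k : Fin 3 → ℤ => ‖fc x k‖ ^ 2) 0 (fun k hk => by rw [hx k hk, norm_zero]; ring)
    exact hPx.unique h
  have hcontr : ‖U s t x‖ ^ 2 ≤ ‖x‖ ^ 2 := pow_le_pow_left₀ (norm_nonneg _) (hU.norm_le s t x) 2
  refine eq_of_fcoeff_eq fun k => ?_
  by_cases hk : k = 0
  · subst hk; exact h0
  · -- every other mode of `U x` vanishes: `‖𝓕(Ux)(0)‖² + ‖𝓕(Ux)(k)‖² ≤ ‖U x‖² ≤ ‖x‖² = ‖𝓕(Ux)(0)‖²`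
    have hpair := sum_le_hasSum ({0, k} : Finset (Fin 3 → ℤ)) (fun k' _ => sq_nonneg ‖fc (U s t x) k'‖) hPU
    rw [Finset.sum_pair (Ne.symm hk)] at hpair
    have hk0 : ‖fc (U s t x) k‖ ^ 2 ≤ 0 := by
      have : ‖fc (U s t x) 0‖ ^ 2 = ‖fc x 0‖ ^ 2 := by rw [h0]
      linarith
    have : fc (U s t x) k = 0 := norm_eq_zero.1 (pow_eq_zero_iff two_ne_zero |>.1 (le_antisymm hk0 (sq_nonneg _)))
    show fc (U s t x) k = fc x k
    rw [this, hx k hk]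

/-! ## §2 The bridge `BssNZ → Bss` -/

set_option maxHeartbeats 1600000 in
/-- **(ss) from (ss) on nonzero slow data**: the constant mode is fixed by both members and decouples. -/
theorem bss_of_bssNZ (e : ℝ → ℝ) (h : BssNZ_textE e) : Bss_textE e := by
  intro k W M hM c hc Φ lo hi Λ β σ C ν₀ K hlo hlo1 hhi hΛ hβ hσ hC hν₀ hν₀1 hK hV
  obtain ⟨C₁, hCC₁, B⟩ := h k W M hM c hc Φ lo hi Λ β σ C ν₀ K hlo hlo1 hhi hΛ hβ hσ hC hν₀ hν₀1 hK hV
  refine ⟨C₁, hCC₁, ?_⟩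
  intro ν hν n hn 𝔸 hodd hwin hΦo hΦw Tw hTw U T hU hT s t hs hst htT x ζ hx hζ
  have hC₁ : 0 ≤ C₁ := hC.trans hCC₁
  -- member facts
  have hn1 : (1:ℝ) ≤ n := by
    have h1 : (1:ℝ) ≤ ⌈K / ν⌉₊ := by
      have : 0 < K / ν := div_pos hK hν.1
      exact_mod_cast Nat.one_le_iff_ne_zero.2 (Nat.pos_iff_ne_zero.1 (Nat.ceil_pos.2 this))
    exact h1.trans hn
  have hnpos : 0 < n := by exact_mod_cast (show (0:ℝ) < n by linarith)
  have hLN : 2 * (n / 4) < n := by omega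
  obtain ⟨lam, hlam, hA𝔸⟩ := hwin
  obtain ⟨lam', hlam', hΦn⟩ := hΦw
  have hlam0 : 0 < lam := by linarith [hlam.1]
  have hlam'0 : 0 < lam' := by linarith [hlam'.1]
  have hcν : 0 ≤ c / ν := div_nonneg hc.le hν.1.le
  have hn2 : (0:ℝ) < 1 / (n:ℝ) ^ 2 := by positivity
  have hcell : Torus.NearIso ((1 / (n:ℝ) ^ 2) • 𝔸) ((1 / (n:ℝ) ^ 2) * (ν * (lo / lam))) ((1 / (n:ℝ) ^ 2) * (ν * (hi * lam))) :=
    hA𝔸.smul hn2.le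
  have hcell_lo : 0 < (1 / (n:ℝ) ^ 2) * (ν * (lo / lam)) := mul_pos hn2 (mul_pos hν.1 (div_pos hlo hlam0))
  have hcoarse : Torus.NearIso ((1 / (n:ℝ) ^ 2) • (𝔸 + (c / ν) • Φ ν ((1 / ν) • 𝔸)))
      ((1 / (n:ℝ) ^ 2) * (ν * (lo / lam) + (c / ν) * (lo / lam'))) ((1 / (n:ℝ) ^ 2) * (ν * (hi * lam) + (c / ν) * (hi * lam'))) :=
    (hA𝔸.add (hΦn.smul hcν)).smul hn2.le
  have hcoarse_lo : 0 < (1 / (n:ℝ) ^ 2) * (ν * (lo / lam) + (c / ν) * (lo / lam')) := by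
    have h1 : 0 < ν * (lo / lam) := mul_pos hν.1 (div_pos hlo hlam0)
    have h2 : 0 ≤ (c / ν) * (lo / lam') := mul_nonneg hcν (div_pos hlo hlam'0).le
    exact mul_pos hn2 (by linarith)
  have hbU : MemLp (Torus.stLift (cellField W M hM ν hν.1 n)) ∞ (volume.restrict (Ioo 0 Tw ×ˢ (univ : Set (EuclideanSpace ℝ (Fin 3))))) :=
    memLp_top_stLift_cell _ n Tw
  have hbUdiv : ∀ᵐ τ ∂(volume.restrict (Ioo (0:ℝ) Tw)), Torus.IsWeaklyDivFree (cellField W M hM ν hν.1 n τ) :=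
    ae_of_all _ fun τ => (isDivFree_cell _ n τ).isWeaklyDivFree_holds (isSmooth_cell _ n τ)
  have hbT : MemLp (Torus.stLift (fun (_ : ℝ) (_ : UnitAddTorus (Fin 3)) => (0 : EuclideanSpace ℝ (Fin 3)))) ∞
      (volume.restrict (Ioo 0 Tw ×ˢ (univ : Set (EuclideanSpace ℝ (Fin 3))))) := memLp_top_const 0
  have hbTdiv : ∀ᵐ τ ∂(volume.restrict (Ioo (0:ℝ) Tw)),
      Torus.IsWeaklyDivFree ((fun (_ : ℝ) (_ : UnitAddTorus (Fin 3)) => (0 : EuclideanSpace ℝ (Fin 3))) τ) :=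
    ae_of_all _ fun τ θ hθ => by simp
  have hgrid : ∀ (j : Fin 3 → Fin n) (τ : ℝ) (y : UnitAddTorus (Fin 3)),
      cellField W M hM ν hν.1 n τ (y + (fun i => ((((j i : ℕ) : ℝ) / n : ℝ) : UnitAddCircle))) = cellField W M hM ν hν.1 n τ y :=
    fun j τ y => by unfold cellField; exact cell_add_grid _ hnpos j τ y
  have hsupp := coarseSupp Tw _ _ _ hcoarse_lo hcoarse T hT s t hs hst.le htT
  -- the split at the zero mode
  set A0 : Set (Fin 3 → ℤ) := {0} with hA0
  obtain ⟨P0, hP0⟩ := exists_labelProj A0 (fun k' => by rw [hA0]; simp)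
  have hP0on : ∀ y : V2, fc (P0 y) 0 = fc y 0 := fun y => by have h := hP0 y 0; rw [if_pos (by rw [hA0]; simp)] at h; exact h
  have hP0off : ∀ (y : V2) k', k' ≠ 0 → fc (P0 y) k' = 0 := fun y k' hk' => by
    have h := hP0 y k'; rw [if_neg (by rw [hA0]; simpa using hk')] at h; exact h
  set x₀ : V2 := P0 x with hx₀
  set x' : V2 := x - P0 x with hx'
  set ζ₀ : V2 := P0 ζ with hζ₀
  set ζ' : V2 := ζ - P0 ζ with hζ'
  have hxsplit : x = x₀ + x' := by rw [hx₀, hx']; abel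
  have hζsplit : ζ = ζ₀ + ζ' := by rw [hζ₀, hζ']; abel
  have nz_of : ∀ y : V2, IsSlow n y → IsSlowNZ n (y - P0 y) := by
    intro y hy k' hk'
    rw [fc_sub]
    by_cases h0 : k' = 0
    · subst h0; rw [hP0on, sub_self]
    · rw [hP0off y k' h0, sub_zero]
      exact hy k' fun hmem => hk' (Finset.mem_erase.2 ⟨h0, hmem⟩)
  have hx'nz : IsSlowNZ n x' := nz_of x hx
  have hζ'nz : IsSlowNZ n ζ' := nz_of ζ hζ
  have hx'0 : fc x' 0 = 0 := hx'nz 0 (by simp)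
  have hζ'0 : fc ζ' 0 = 0 := hζ'nz 0 (by simp)
  -- the constant parts are fixed by both members
  have hUx₀ : U s t x₀ = x₀ := apply_eq_self_of_supp_zero hcell hcell_lo hbU hbUdiv hU hs hst.le htT x₀ (hP0off x)
  have hTx₀ : T s t x₀ = x₀ := apply_eq_self_of_supp_zero hcoarse hcoarse_lo hbT hbTdiv hT hs hst.le htT x₀ (hP0off x)
  -- the zero mode of `(U−T)x'` vanishes: `x'` has no coefficient on the class pair of `0`
  have hx'class : ∀ k', ((∀ i, (n:ℤ) ∣ k' i - (0 : Fin 3 → ℤ) i) ∨ (∀ i, (n:ℤ) ∣ k' i + (0 : Fin 3 → ℤ) i)) →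
      mFourierCoeff (EuclideanSpace.complexify ∘ ⇑x') k' = 0 := by
    intro k' hk'
    by_cases hmem : k' ∈ (Torus.freqBall (d := Fin 3) (n / 4)).erase 0
    · have hk'ball := Finset.mem_of_mem_erase hmem
      have h0ball : (0 : Fin 3 → ℤ) ∈ Torus.freqBall (d := Fin 3) (n / 4) := by
        rw [Torus.mem_freqBall]; simp [Torus.freqNormSq]
      rcases FlatWindow.alone_of_lt hLN h0ball hk'ball hk' with h | h
      · exact absurd h (Finset.ne_of_mem_erase hmem)
      · exact absurd (by simpa using h) (Finset.ne_of_mem_erase hmem)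
    · exact hx'nz k' hmem
  have hUx'0 : fc (U s t x') 0 = 0 :=
    PropagatorSymm.fcoeff_apply_eq_zero_of_classes hU hcell hcell_lo hbU hbUdiv hnpos hgrid 0 hs hst.le htT x' hx'class 0 (Or.inl fun i => by simp)
  have hTx'0 : fc (T s t x') 0 = 0 := (hsupp x' 0 hx'0).1
  have hdiff0 : fc (U s t x' - T s t x') 0 = 0 := by rw [fc_sub, hUx'0, hTx'0, sub_self]
  -- the pairing reduces to the nonzero parts
  have hpair : ⟪U s t x - T s t x, ζ⟫_ℝ = ⟪U s t x' - T s t x', ζ'⟫_ℝ := by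
    have e1 : U s t x - T s t x = U s t x' - T s t x' := by
      rw [hxsplit, map_add, map_add, hUx₀, hTx₀]; abel
    rw [e1, hζsplit, inner_add_right]
    have hz : ⟪U s t x' - T s t x', ζ₀⟫_ℝ = 0 := by
      refine inner_eq_zero_of_fc_disjoint fun k' => ?_
      by_cases h0 : k' = 0
      · subst h0; exact Or.inl hdiff0
      · exact Or.inr (hP0off ζ k' h0)
    rw [hz, zero_add]
  -- the block on the nonzero parts
  have hB := B ν hν n hn 𝔸 hodd ⟨lam, hlam, hA𝔸⟩ hΦo ⟨lam', hlam', hΦn⟩ Tw hTw U T hU hT s t hs hst htT x' ζ' hx'nz hζ'nz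
  -- losses only grow: `q_T(x') ≤ q_T(x)`, `q*_T(ζ') ≤ q*_T(ζ)`
  have hTc : ∀ y, ‖T s t y‖ ≤ ‖y‖ := hT.norm_le s t
  have hox : ⟪x₀, x'⟫_ℝ = 0 := inner_eq_zero_of_fc_disjoint fun k' => by
    by_cases h0 : k' = 0
    · subst h0; exact Or.inr hx'0
    · exact Or.inl (hP0off x k' h0)
  have hoTx : ⟪T s t x₀, T s t x'⟫_ℝ = 0 := inner_eq_zero_of_fc_disjoint fun k' => by
    by_cases h0 : k' = 0
    · subst h0; exact Or.inr hTx'0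
    · exact Or.inl ((hsupp x₀ k' (hP0off x k' h0)).1)
  have hoζ : ⟪ζ₀, ζ'⟫_ℝ = 0 := inner_eq_zero_of_fc_disjoint fun k' => by
    by_cases h0 : k' = 0
    · subst h0; exact Or.inr hζ'0
    · exact Or.inl (hP0off ζ k' h0)
  have hoAζ : ⟪ContinuousLinearMap.adjoint (T s t) ζ₀, ContinuousLinearMap.adjoint (T s t) ζ'⟫_ℝ = 0 :=
    inner_eq_zero_of_fc_disjoint fun k' => by
      by_cases h0 : k' = 0
      · subst h0; exact Or.inr ((hsupp ζ' 0 hζ'0).2)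
      · exact Or.inl ((hsupp ζ₀ k' (hP0off ζ k' h0)).2)
  have hq : lossFwd (T s t) x' ≤ lossFwd (T s t) x := by
    have hadd : lossFwd (T s t) x = lossFwd (T s t) x₀ + lossFwd (T s t) x' := by
      unfold lossFwd; rw [hxsplit]; exact loss_add_of_orthogonal hox hoTx
    have h0 : 0 ≤ lossFwd (T s t) x₀ := loss_nonneg hTc x₀
    rw [hadd]; linarith
  have hqs : lossAdj (T s t) ζ' ≤ lossAdj (T s t) ζ := by
    have hadd : lossAdj (T s t) ζ = lossAdj (T s t) ζ₀ + lossAdj (T s t) ζ' := by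
      unfold lossAdj; rw [hζsplit]; exact loss_add_of_orthogonal hoζ hoAζ
    have h0 : 0 ≤ lossAdj (T s t) ζ₀ := lossAdj_nonneg hTc ζ₀
    rw [hadd]; linarith
  have hP0' : 0 ≤ (M * W.period / ν) / (t - s) :=
    div_nonneg (div_nonneg (mul_nonneg hM.le
      (Summit.AnomalousDissipation.AnomalousDissipation.Theorems.SolenoidalFractalHomogenisation.PermissibleCarrier.period_pos W).le) hν.1.le)
      (by linarith)
  have hη0 : 0 ≤ C₁ * (C₁ * (ν ^ e σ + ((⌈K / ν⌉₊ : ℝ) / n) ^ e σ) + (min 1 ((M * W.period / ν) / (t - s))) ^ e σ) := by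
    have h1 : 0 ≤ ν ^ e σ := Real.rpow_nonneg hν.1.le _
    have h2 : 0 ≤ ((⌈K / ν⌉₊ : ℝ) / n) ^ e σ := Real.rpow_nonneg (by positivity) _
    have h3 : 0 ≤ (min 1 ((M * W.period / ν) / (t - s))) ^ e σ := Real.rpow_nonneg (le_min zero_le_one hP0') _
    exact mul_nonneg hC₁ (by positivity)
  rw [hpair]
  refine hB.trans ?_
  exact mul_le_mul (mul_le_mul_of_nonneg_left (Real.sqrt_le_sqrt hq) hη0) (Real.sqrt_le_sqrt hqs) (Real.sqrt_nonneg _)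
    (mul_nonneg hη0 (Real.sqrt_nonneg _))

/-- **(ss) ⇐ the single-pair modewise bound** (`bssNZ_of_ssMode` ∘ `bss_of_bssNZ`). -/
theorem bss_of_ssMode (e : ℝ → ℝ) (h : SSMode_textE e) : Bss_textE e := bss_of_bssNZ e (bssNZ_of_ssMode e h)

end Summit.AnomalousDissipation.AnomalousDissipation.Theorems.SolenoidalFractalHomogenisation.LagrangianStep.VmodFlat

end
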